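import Literature.Geometry.Riemannian.HeatKernelBasePointContinuity
import Literature.Geometry.Riemannian.LinearHeatWeakExistence
import Mathlib.Analysis.SpecialFunctions.SmoothTransition
import Literature.Geometry.Riemannian.ChartTestFunctions
import HarnessLib

/-!
# The conjugate heat kernel solves the heat equation in the base point, very weakly
# (Bamler 2020a, §2.3: `□_{(x,t)} K(x,t;y,s) = 0`)

R. Bamler, *Entropy and heat kernel bounds on a Ricci flow background*, arXiv:2008.07093 (2020a),
§2.3: the heat kernel `K(x,t;y,s)` solves the heat equation `∂ₜ K = Δ_{x,h(t)} K` in the base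
variables `(x, t)`. This file proves the very weak (distributional, space-time) form of this
statement for the kernel function `𝒦 t x (y, s)` of `HeatKernelBasePointContinuity.lean`, in the
format consumed by the interior regularity theorem
`exists_contMDiffOn_ae_eq_of_linearHeat_veryWeak` (reference metric `g₀`, density ratio
`ρ = dV_{h(t)}/dV_{g₀}`):

* `integral_heatValue_mul_heatAdjoint_eq_zero` — the smooth space-time heat propagation
  `u(x, t) = (P_{s→t} φ)(x)` of a smooth datum satisfies `∫ u (−∂ₜ(ρζ) − ρ Δ_{h(t)} ζ) = 0` for all
  smooth `ζ` compactly supported in `M × (s, ∞)` (space-time Green identity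
  `integral_mul_heatAdjoint_eq` applied to a time cut-off of `u`, and `∂ₜu = Δu`).
* `integral_conjugateHeatKernel_timeFamily_mul_heatAdjoint_eq_zero` — for every `(y, s)`,
  `u(x, t) = 𝒦 t x (y, s)` satisfies the same identity for tests supported in `M × (s, T)`:
  pairing with smooth `φ(y)` reduces to the previous statement (`∫ φ(y) 𝒦 t x (y, s) dV_s(y) =
  (P_{s→t} φ)(x)`, Fubini), and the continuity of `y ↦ ∫ 𝒦 t x (y, s) 𝒜ζ(x, t)` (joint continuity
  `continuousOn_conjugateHeatKernel_timeFamily`) lets the fundamental lemma conclude for every `y`.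

Everything is proved; no definitions, no named facts.

## References

* R. H. Bamler, *Entropy and heat kernel bounds on a Ricci flow background*, arXiv:2008.07093
  (2020), §2.3. [Bamler2020Entropy]
* F. Trèves, *Basic linear partial differential equations*, Academic Press 1975, §41. [Treves1975]
-/

noncomputable section

open Bundle Set Function Filter Manifold MeasureTheory Measure TopologicalSpace
open scoped Manifold ContDiff Topology ENNReal NNReal

namespace Literature.Geometry.Riemannian

open Lorentzian Lorentzian.PseudoRiemannianMetric

/-- The closed support of `q ↦ k q.1` is contained in `(tsupport k) ×ˢ univ`. [folklore] -/
theorem tsupport_comp_fst_subset {X Y : Type*} [TopologicalSpace X] [TopologicalSpace Y]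
    (k : X → ℝ) : tsupport (fun q : X × Y ↦ k q.1) ⊆ tsupport k ×ˢ (univ : Set Y) := by
  refine closure_minimal (fun q hq ↦ ⟨subset_tsupport _ hq, mem_univ _⟩) ?_
  exact (isClosed_tsupport k).prod isClosed_univ

/-- **A smooth monotone time cut-off**: for `s' < σ` there is a `C^∞` `χ : ℝ → ℝ` with `χ = 0` on
`(−∞, s']` and `χ = 1` on `[σ, ∞)` (`Real.smoothTransition`). [folklore] -/
theorem exists_smoothTransition_time_cutoff {s' σ : ℝ} (h : s' < σ) :
    ∃ χ : ℝ → ℝ, ContDiff ℝ ∞ χ ∧ (∀ t ≤ s', χ t = 0) ∧ (∀ t, σ ≤ t → χ t = 1) := by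
  refine ⟨fun t ↦ Real.smoothTransition ((t - s') / (σ - s')),
    Real.smoothTransition.contDiff.comp ((contDiff_id.sub contDiff_const).div_const _),
    fun t ht ↦ Real.smoothTransition.zero_of_nonpos
      (div_nonpos_of_nonpos_of_nonneg (by linarith) (by linarith)),
    fun t ht ↦ Real.smoothTransition.one_of_one_le ?_⟩
  rw [le_div_iff₀ (by linarith), one_mul]
  linarith

section VeryWeakForward

variable {m : ℕ} {H : Type*} [TopologicalSpace H]
  {I : ModelWithCorners ℝ (EuclideanSpace ℝ (Fin m)) H} [I.Boundaryless]
  {M : Type*} [TopologicalSpace M] [ChartedSpace H M] [IsManifold I ∞ M]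
  [T2Space M] [CompactSpace M] [SecondCountableTopology M] [MeasurableSpace M] [BorelSpace M]
  {h : ℝ → PseudoRiemannianMetric I ∞ (EuclideanSpace ℝ (Fin m)) (TangentSpace I : M → Type _)}
  {g₀ : PseudoRiemannianMetric I ∞ (EuclideanSpace ℝ (Fin m)) (TangentSpace I : M → Type _)}
  (hh : IsContMDiffFamilyOn ∞ h univ) (hR : ∀ r, (h r).IsRiemannian)

omit [T2Space M] [CompactSpace M] [SecondCountableTopology M] [MeasurableSpace M] [BorelSpace M]
  [I.Boundaryless] [IsManifold I ∞ M] in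
/-- **Gluing by a time cut-off**: if `v` is `C^∞` on `M × (s, ∞)` and `χ` is smooth with `χ = 0`
on `(−∞, s']`, `s < s'`, then `(x, t) ↦ χ(t) v(x, t)` is `C^∞` on all of `M × ℝ`. [folklore] -/
theorem contMDiff_cutoff_mul_of_contMDiffOn {s s' : ℝ} (hss' : s < s') {v : M × ℝ → ℝ}
    (hv : ContMDiffOn (I.prod 𝓘(ℝ, ℝ)) 𝓘(ℝ, ℝ) ∞ v (univ ×ˢ Ioi s)) {χ : ℝ → ℝ}
    (hχ : ContDiff ℝ ∞ χ) (hχ0 : ∀ t ≤ s', χ t = 0) :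
    ContMDiff (I.prod 𝓘(ℝ, ℝ)) 𝓘(ℝ, ℝ) ∞ fun p : M × ℝ ↦ χ p.2 * v p := by
  intro p
  by_cases hp : s < p.2
  · have hmem : (univ : Set M) ×ˢ Ioi s ∈ 𝓝 p :=
      (isOpen_univ.prod isOpen_Ioi).mem_nhds ⟨mem_univ _, hp⟩
    have hχ' : ContMDiff (I.prod 𝓘(ℝ, ℝ)) 𝓘(ℝ, ℝ) ∞ fun p : M × ℝ ↦ χ p.2 :=
      hχ.contMDiff.comp contMDiff_snd
    exact (hχ'.contMDiffOn.mul hv).contMDiffAt hmem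
  · have hmem : (univ : Set M) ×ˢ Iio s' ∈ 𝓝 p :=
      (isOpen_univ.prod isOpen_Iio).mem_nhds ⟨mem_univ _, (not_lt.1 hp).trans_lt hss'⟩
    have hev : (fun p : M × ℝ ↦ χ p.2 * v p) =ᶠ[𝓝 p] fun _ ↦ (0 : ℝ) :=
      eventuallyEq_of_mem hmem fun q hq ↦ by
        show χ q.2 * v q = (0 : ℝ)
        rw [hχ0 q.2 (le_of_lt hq.2), zero_mul]
    exact contMDiffAt_const.congr_of_eventuallyEq hev

include hh hR in
/-- **The heat propagation solves the heat equation very weakly in space-time**: for a `C^∞`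
family `h` of Riemannian metrics on a closed manifold, a Riemannian reference metric `g₀` with
density ratio `ρ = dV_{h(t)}/dV_{g₀}`, a smooth datum `φ` at time `s` and every smooth `ζ` with
compact support inside `M × (s, ∞)`,

  `∫ (P_{s→t}φ)(x) · (−∂ₜ(ρζ) − ρ Δ_{h(t)}ζ)(x, t) d(V_{g₀} ⊗ dt) = 0`

(space-time Green identity `integral_mul_heatAdjoint_eq` for a time cut-off of the smooth
space-time propagation, which solves `∂ₜu = Δ_{h(t)}u` for `t > s`, `hasDerivAt_heatValue`).
[cite: Treves1975, §41, (41.20)–(41.21)] [cite: Bamler2020Entropy, §2] -/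
theorem integral_heatValue_mul_heatAdjoint_eq_zero (hR₀ : g₀.IsRiemannian) {s : ℝ} {φ : M → ℝ}
    (hφ : ContMDiff I 𝓘(ℝ, ℝ) ∞ φ) {ζ : M × ℝ → ℝ} (hζ : ContMDiff (I.prod 𝓘(ℝ, ℝ)) 𝓘(ℝ, ℝ) ∞ ζ)
    (hζc : HasCompactSupport ζ) (hζT : tsupport ζ ⊆ univ ×ˢ Ioi s) :
    ∫ p, heatValue h s p.2 p.1 φ *
        (-(deriv (fun t ↦ (h t).densityRatio g₀ p.1 * ζ (p.1, t)) p.2) -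
          (h p.2).densityRatio g₀ p.1 * (h p.2).laplaceBeltrami (fun x ↦ ζ (x, p.2)) p.1)
      ∂g₀.riemVolume.prod (volume : Measure ℝ) = 0 := by
  set u : M × ℝ → ℝ := fun p ↦ heatValue h s p.2 p.1 φ with hu
  have hus : ContMDiffOn (I.prod 𝓘(ℝ, ℝ)) 𝓘(ℝ, ℝ) ∞ u (univ ×ˢ Ioi s) :=
    (contMDiffOn_heatValue_spaceTime hh hR s hφ).mono (prod_mono le_rfl Ioi_subset_Ici_self)
  -- the time support `K ⊆ (σ, ∞)` for some `σ > s`, and a cut-off `χ` (`0` below `s'`, `1` above `σ`)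
  set K : Set ℝ := Prod.snd '' tsupport ζ with hK
  have hKc : IsCompact K := hζc.image continuous_snd
  have hKs : K ⊆ Ioi s := by
    rintro t ⟨p, hp, rfl⟩
    exact (hζT hp).2
  obtain ⟨σ, hsσ, hKσ⟩ : ∃ σ, s < σ ∧ K ⊆ Ioi σ := by
    rcases K.eq_empty_or_nonempty with hKe | hKne
    · exact ⟨s + 1, by linarith, by simp [hKe]⟩
    · have hmin := hKc.isLeast_sInf hKne
      have h0 : s < sInf K := hKs hmin.1
      refine ⟨(s + sInf K) / 2, by linarith, fun t ht ↦ ?_⟩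
      have := hmin.2 ht
      show (s + sInf K) / 2 < t
      linarith
  set s' : ℝ := (s + σ) / 2 with hs'
  have hss' : s < s' := by rw [hs']; linarith
  have hs'σ : s' < σ := by rw [hs']; linarith
  obtain ⟨χ, hχ, hχ0, hχ1⟩ := exists_smoothTransition_time_cutoff hs'σ
  set v : M × ℝ → ℝ := fun p ↦ χ p.2 * u p with hv
  have hvs : ContMDiff (I.prod 𝓘(ℝ, ℝ)) 𝓘(ℝ, ℝ) ∞ v :=
    contMDiff_cutoff_mul_of_contMDiffOn hss' hus hχ hχ0
  have hχK : ∀ p ∈ tsupport ζ, ∀ᶠ t in 𝓝 p.2, χ t = 1 := fun p hp ↦ by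
    have hσp : σ < p.2 := hKσ ⟨p, hp, rfl⟩
    filter_upwards [Ioi_mem_nhds hσp] with t ht using hχ1 t (le_of_lt ht)
  -- the space-time Green identity for `v`, with `Q = 0`
  have key := integral_mul_heatAdjoint_eq (g₀ := g₀) (Q := fun _ _ ↦ (0 : ℝ)) hh hR hR₀
    contMDiff_const hvs hζ hζc
  -- its left side is ours
  have hL : ∀ p : M × ℝ, u p *
      (-(deriv (fun t ↦ (h t).densityRatio g₀ p.1 * ζ (p.1, t)) p.2) -
        (h p.2).densityRatio g₀ p.1 * (h p.2).laplaceBeltrami (fun x ↦ ζ (x, p.2)) p.1) =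
      v p * (-(deriv (fun t ↦ (h t).densityRatio g₀ p.1 * ζ (p.1, t)) p.2) -
        (h p.2).densityRatio g₀ p.1 * (h p.2).laplaceBeltrami (fun x ↦ ζ (x, p.2)) p.1 +
        (h p.2).densityRatio g₀ p.1 * (fun (_ : ℝ) (_ : M) ↦ (0 : ℝ)) p.2 p.1 * ζ p) := by
    intro p
    simp only [mul_zero, zero_mul, add_zero]
    by_cases hp : p ∈ tsupport ζ
    · simp only [hv, (hχK p hp).self_of_nhds, one_mul]
    · have h0 := heatAdjoint_eq_zero_of_notMem_tsupport (h := h) (g₀ := g₀)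
        (Q := fun (_ : ℝ) (_ : M) ↦ (0 : ℝ)) hp
      simp only [mul_zero, zero_mul, add_zero] at h0
      rw [h0, mul_zero, mul_zero]
  -- its right side vanishes: `∂ₜv − Δv = 0` on `tsupport ζ` (there `v = u` near the point)
  have hRz : ∀ p : M × ℝ, (h p.2).densityRatio g₀ p.1 * (deriv (fun t ↦ v (p.1, t)) p.2 -
      (h p.2).laplaceBeltrami (fun x ↦ v (x, p.2)) p.1 +
        (fun (_ : ℝ) (_ : M) ↦ (0 : ℝ)) p.2 p.1 * v p) * ζ p = 0 := by
    intro p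
    by_cases hp : p ∈ tsupport ζ
    · have hsp : s < p.2 := hKs ⟨p, hp, rfl⟩
      have h1 : χ p.2 = 1 := (hχK p hp).self_of_nhds
      have hd : deriv (fun t ↦ v (p.1, t)) p.2 =
          (h p.2).laplaceBeltrami (fun x ↦ u (x, p.2)) p.1 := by
        have hev : (fun t ↦ v (p.1, t)) =ᶠ[𝓝 p.2] fun t ↦ u (p.1, t) := by
          filter_upwards [hχK p hp] with t ht
          simp only [hv, ht, one_mul]
        rw [hev.deriv_eq]
        exact (hasDerivAt_heatValue hh hR hsp hφ p.1).deriv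
      have hsl : (fun x ↦ v (x, p.2)) = fun x ↦ u (x, p.2) := by
        funext x; simp only [hv, h1, one_mul]
      rw [hd, hsl]
      simp
    · rw [image_eq_zero_of_notMem_tsupport hp, mul_zero]
  rw [integral_congr_ae (Eventually.of_forall hL), key]
  exact integral_eq_zero_of_ae (Eventually.of_forall hRz)

include hh hR in
/-- **`K(x,t;y,s)` solves the heat equation in `(x, t)`, very weakly** (Bamler 2020a, §2.3):
let `𝒦 t x (y, s)`, `t ∈ (a, T]`, be nonnegative jointly continuous densities of the heat kernel
measures `ν_{x,t;s}`, `s ∈ (a, t)`, of a `C^∞` family of Riemannian metrics on a closed manifold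
(`IsRicciFlow.exists_conjugateHeatKernel_timeFamily`), `g₀` a Riemannian reference metric with
`ρ = dV_{h(t)}/dV_{g₀}`, `s ∈ (a, T)` and `y ∈ M`. Then for every smooth `ζ` with compact
support inside `M × (s, T)`,

  `∫ 𝒦 t x (y, s) · (−∂ₜ(ρζ) − ρ Δ_{h(t)}ζ)(x, t) d(V_{g₀}(x) ⊗ dt) = 0`.

Pairing the left side with a smooth `φ(y) dV_{h(s)}(y)` and using
`∫ φ(y) 𝒦 t x (y, s) dV_{h(s)}(y) = (P_{s→t}φ)(x)` reduces to
`integral_heatValue_mul_heatAdjoint_eq_zero` (Fubini); the left side is continuous in `y`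
(`continuousOn_conjugateHeatKernel_timeFamily`), so the fundamental lemma gives `0` for every
`y`. [cite: Bamler2020Entropy, §2.3] -/
theorem integral_conjugateHeatKernel_timeFamily_mul_heatAdjoint_eq_zero (hR₀ : g₀.IsRiemannian)
    {a T : ℝ} {𝒦 : ℝ → M → M × ℝ → ℝ}
    (h𝒦0 : ∀ t ∈ Ioc a T, ∀ x, ∀ p ∈ univ ×ˢ Ioo a t, 0 ≤ 𝒦 t x p)
    (h𝒦ν : ∀ t ∈ Ioc a T, ∀ x, ∀ s ∈ Ioo a t, heatKernelMeasure hh hR t x s =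
      (h s).riemVolume.withDensity fun y ↦ ENNReal.ofReal (𝒦 t x (y, s)))
    (h𝒦c : ∀ t ∈ Ioc a T, ContinuousOn (fun q : M × (M × ℝ) ↦ 𝒦 t q.1 q.2)
      (univ ×ˢ (univ ×ˢ Ioo a t)))
    {s : ℝ} (hs : s ∈ Ioo a T) (y : M) {ζ : M × ℝ → ℝ}
    (hζ : ContMDiff (I.prod 𝓘(ℝ, ℝ)) 𝓘(ℝ, ℝ) ∞ ζ) (hζc : HasCompactSupport ζ)
    (hζT : tsupport ζ ⊆ univ ×ˢ Ioo s T) :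
    ∫ p, 𝒦 p.2 p.1 (y, s) *
        (-(deriv (fun t ↦ (h t).densityRatio g₀ p.1 * ζ (p.1, t)) p.2) -
          (h p.2).densityRatio g₀ p.1 * (h p.2).laplaceBeltrami (fun x ↦ ζ (x, p.2)) p.1)
      ∂g₀.riemVolume.prod (volume : Measure ℝ) = 0 := by
  haveI : MetrizableSpace M := TopologicalSpace.metrizableSpace_of_t3_secondCountable M
  set μ₀ : Measure M := g₀.riemVolume with hμ₀
  haveI : IsFiniteMeasure μ₀ := ⟨by rw [hμ₀]; exact g₀.riemVolume_univ_lt_top⟩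
  set ν : Measure (M × ℝ) := μ₀.prod (volume : Measure ℝ) with hν
  set Vs : Measure M := (h s).riemVolume with hVs
  haveI : IsFiniteMeasure Vs := ⟨(h s).riemVolume_univ_lt_top⟩
  haveI : Vs.IsOpenPosMeasure := by
    rw [hVs, riemVolume_eq (hR s)]
    exact isOpenPosMeasure_riemannianMeasure _
  -- the bracket `A = −∂ₜ(ρζ) − ρΔζ`: continuous, supported in `tsupport ζ ⊆ O = M × (s, T)`
  set A : M × ℝ → ℝ := fun p ↦ -(deriv (fun t ↦ (h t).densityRatio g₀ p.1 * ζ (p.1, t)) p.2) -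
    (h p.2).densityRatio g₀ p.1 * (h p.2).laplaceBeltrami (fun x ↦ ζ (x, p.2)) p.1 with hA
  have hAc : Continuous A := by
    have h1 := (contMDiff_heatAdjoint (g₀ := g₀) (Q := fun (_ : ℝ) (_ : M) ↦ (0 : ℝ)) hh hR hR₀
      contMDiff_const hζ).continuous
    exact h1.congr fun p ↦ by simp [hA]
  have hA0 : ∀ p ∉ tsupport ζ, A p = 0 := fun p hp ↦ by
    have h0 := heatAdjoint_eq_zero_of_notMem_tsupport (h := h) (g₀ := g₀)
      (Q := fun (_ : ℝ) (_ : M) ↦ (0 : ℝ)) hp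
    simpa [hA] using h0
  have hAT : tsupport A ⊆ tsupport ζ :=
    closure_minimal (fun p hp ↦ by_contra fun h' ↦ hp (hA0 p h')) (isClosed_tsupport ζ)
  set O : Set (M × ℝ) := univ ×ˢ Ioo s T with hO
  have hOo : IsOpen O := isOpen_univ.prod isOpen_Ioo
  have hbase : ∀ p ∈ O, p.2 ∈ Ioc a T ∧ s ∈ Ioo a p.2 := fun p hp ↦
    ⟨⟨hs.1.trans hp.2.1, hp.2.2.le⟩, hs.1, hp.2.1⟩
  -- the jointly continuous integrand `F (p, y') = 𝒦 p.2 p.1 (y', s) A p` on `(M × ℝ) × M`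
  set F : (M × ℝ) × M → ℝ := fun q ↦ 𝒦 q.1.2 q.1.1 (q.2, s) * A q.1 with hF
  have hE : ContinuousOn (fun q : (M × ℝ) × M ↦ 𝒦 q.1.2 q.1.1 (q.2, s)) (O ×ˢ univ) :=
    (continuousOn_conjugateHeatKernel_timeFamily hh hR h𝒦0 h𝒦ν h𝒦c hs).mono
      (prod_mono (prod_mono le_rfl Ioo_subset_Ioc_self) le_rfl)
  have hFc : Continuous F :=
    continuous_mul_of_continuousOn_of_tsupport_subset (hOo.prod isOpen_univ) hE
      (hAc.comp continuous_fst)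
      ((tsupport_comp_fst_subset A).trans (prod_mono (hAT.trans hζT) le_rfl))
  have hF0 : ∀ q : (M × ℝ) × M, q.1 ∉ tsupport ζ → F q = 0 := fun q hq ↦ by
    simp only [hF, hA0 q.1 hq, mul_zero]
  have hFsupp : HasCompactSupport F := by
    refine HasCompactSupport.intro (hζc.prod isCompact_univ) fun q hq ↦ hF0 q fun h' ↦ hq ⟨h', mem_univ _⟩
  -- `G y' = ∫ F (·, y')` is continuous
  set G : M → ℝ := fun y' ↦ ∫ p, F (p, y') ∂ν with hG
  have hGc : Continuous G := by
    have h1 := continuous_parametric_integral_of_continuous (μ := ν)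
      (f := fun (y' : M) (p : M × ℝ) ↦ F (p, y'))
      (hFc.comp (continuous_snd.prodMk continuous_fst)) hζc.isCompact
    refine h1.congr fun y' ↦ ?_
    exact setIntegral_eq_integral_of_forall_compl_eq_zero fun p hp ↦ hF0 (p, y') hp
  -- pairing with smooth `ψ(y') dV_s(y')` gives zero
  have key : ∀ ψ : M → ℝ, ContMDiff I 𝓘(ℝ, ℝ) ∞ ψ → ∫ y', G y' * ψ y' ∂Vs = 0 := by
    intro ψ hψ
    obtain ⟨B, hB⟩ : ∃ B, ∀ y', |ψ y'| ≤ B := by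
      obtain ⟨B, hB⟩ := isCompact_univ.exists_bound_of_continuousOn hψ.continuous.continuousOn
      exact ⟨B, fun y' ↦ (Real.norm_eq_abs _).symm.le.trans (hB y' (mem_univ _))⟩
    -- Fubini for `(y', p) ↦ F (p, y') ψ y'`
    have hint : Integrable (uncurry fun (y' : M) (p : M × ℝ) ↦ F (p, y') * ψ y') (Vs.prod ν) := by
      have hc : Continuous fun q : M × (M × ℝ) ↦ F (q.2, q.1) * ψ q.1 :=
        (hFc.comp (continuous_snd.prodMk continuous_fst)).mul (hψ.continuous.comp continuous_fst)
      refine hc.integrable_of_hasCompactSupport ?_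
      refine HasCompactSupport.intro (isCompact_univ.prod hζc) fun q hq ↦ ?_
      show F (q.2, q.1) * ψ q.1 = 0
      rw [hF0 (q.2, q.1) fun h' ↦ hq ⟨mem_univ _, h'⟩, zero_mul]
    have hswap := integral_integral_swap hint
    have e1 : (fun y' ↦ G y' * ψ y') = fun y' ↦ ∫ p, F (p, y') * ψ y' ∂ν := by
      funext y'
      rw [← integral_mul_const]
    rw [e1, hswap]
    -- at each `p`: `∫ F (p, y') ψ y' dV_s(y') = A p · (P_{s→p.2} ψ)(p.1)`
    have hinner : ∀ p : M × ℝ, ∫ y', F (p, y') * ψ y' ∂Vs = heatValue h s p.2 p.1 ψ * A p := by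
      intro p
      by_cases hp : p ∈ tsupport ζ
      · have hpO : p ∈ O := hζT hp
        obtain ⟨ht, hsp⟩ := hbase p hpO
        have hKc' : Continuous fun y' ↦ 𝒦 p.2 p.1 (y', s) :=
          (h𝒦c p.2 ht).comp_continuous
            (continuous_const.prodMk (continuous_id.prodMk continuous_const))
            fun _ ↦ ⟨mem_univ _, mem_univ _, hsp⟩
        have hrepr : ∫ y', ψ y' ∂(heatKernelMeasure hh hR p.2 p.1 s) =
            ∫ y', ψ y' * 𝒦 p.2 p.1 (y', s) ∂Vs := by
          rw [h𝒦ν p.2 ht p.1 s hsp, integral_withDensity_eq_integral_toReal_smul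
            hKc'.measurable.ennreal_ofReal (Eventually.of_forall fun _ ↦ ENNReal.ofReal_lt_top)]
          refine integral_congr_ae (Eventually.of_forall fun y' ↦ ?_)
          show (ENNReal.ofReal (𝒦 p.2 p.1 (y', s))).toReal • ψ y' = ψ y' * 𝒦 p.2 p.1 (y', s)
          rw [ENNReal.toReal_ofReal (h𝒦0 p.2 ht p.1 _ ⟨mem_univ _, hsp⟩), smul_eq_mul, mul_comm]
        rw [← integral_heatKernelMeasure_eq_heatValue hh hR hsp.2 p.1 hψ, hrepr, ← integral_mul_const]
        refine integral_congr_ae (Eventually.of_forall fun y' ↦ ?_)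
        simp only [hF]
        ring
      · have h0 : ∀ y', F (p, y') * ψ y' = 0 := fun y' ↦ by rw [hF0 (p, y') hp, zero_mul]
        simp only [h0, integral_zero, hA0 p hp, mul_zero]
    rw [integral_congr_ae (Eventually.of_forall hinner)]
    exact integral_heatValue_mul_heatAdjoint_eq_zero hh hR hR₀ hψ hζ hζc
      (hζT.trans (prod_mono le_rfl Ioo_subset_Ioi_self))
  -- the fundamental lemma: `G = 0`
  have hzero := eqOn_zero_of_forall_integral_mul_contMDiff_eq_zero (J := I) Vs isOpen_univ
    hGc.continuousOn (fun ψ hψ _ _ _ ↦ key ψ hψ)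
  have hGy : G y = 0 := hzero y (mem_univ y)
  simpa only [hG, hF] using hGy

end VeryWeakForward

end Literature.Geometry.Riemannian

end
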